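import Mathlib.Algebra.Module.CharacterModule
import Mathlib.Algebra.Exact.Basic
import Mathlib.LinearAlgebra.Quotient.Basic
import Mathlib.RingTheory.Ideal.Maps
import HarnessLib

/-!
# Route `ErratumRoadFive` (K2, `p ≥ 5`), crux (T) `Rest3TorsionBranchAtFive` (item
# stmt-BirchSwinnertonDyer-19702): Pontryagin duality WITH A DEFECT — the dual of
# `P →ʲ S → S/j(P) → 0` is `0 → (S/j(P))^∨ → S^∨ → P^∨`, exact, and an annihilator of the cokernel
# annihilates its dual (THEOREM T♭, memo §31.2 (F): the glue (G1) between Lemma 2.1♭ and the bounded limit)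

Cell `bsd-stepL` (run/shared/lean/pub/bsd-stepL/), seat `bsd-stepL-bdp` (prover g14, 2026-08-26), memo
`HOME/proof/PROOF-BDP.md` §31.2 (F) / §32.8 (G1); `--supports stmt-BirchSwinnertonDyer-19702 --as helper`.
Companion of multr1-p1's `X11b/PontryaginCongruence.lean` (the EXACT case: `S[a^m] ≃ S'[a^m] ⟹
S^∨/(a)^m ≃ S'^∨/(a)^m`), for Mathlib's character module `S^∨ = Hom_ℤ(S, ℚ/ℤ)` (`CharacterModule S`, an
`R`-module by precomposition), any commutative ring `R`.

HONEST FRAMING: PURE ALGEBRA (theorems only; no definition, no named fact, no `sorry`); nothing about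
Selmer groups or any preprint is asserted; nothing is booked; no census word, tier or label moves (T7).

## What and why

In THEOREM T♭ the comparison `j_m : Sel(M_{g_m}[ϖ^m]) → Sel(M_{g_m})[ϖ^m]` is INJECTIVE with a cokernel
`C_m` killed by `p^k` (Lemma 2.1♭: `ErratumRoadFiveSelmerControlDefect.smul_mem_map_selmer_*`, with (L1)
∕ §31.2 (g)), instead of an isomorphism. Dualising (memo §31.2 (F)): `X_m/ϖ^m X_m = (Sel(M_{g_m})[ϖ^m])^∨
↠ Q_m := Sel(M_{g_m}[ϖ^m])^∨` with kernel `K'_m = C_m^∨`, killed by `p^k` — the binders `ι`, `β`, `hex`,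
`hβ`, `hkill` of g13's `BoundedCongruenceLimit.charIdeal_le_span_of_congruences_boundedKernel`. THIS FILE is
that dualisation, generically, for an `R`-linear `j : P → S`:

* `dual_mkQ_injective` — `(S/U)^∨ ↪ S^∨` (dual of a surjection);
* `exact_dual_mkQ_dual` — **`0 → (S/j(P))^∨ → S^∨ →^{j^∨} P^∨` is exact at `S^∨`**: a character of `S`
  vanishing on `j(P)` factors through `S/j(P)` (and conversely);
* `dual_surjective_of_injective'` — `j` injective ⟹ `j^∨ : S^∨ ↠ P^∨` (Mathlib, `ℚ/ℤ` injective);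
* `mem_annihilator_characterModule_of_forall_smul_mem` — if `a • s ∈ j(P)` for every `s ∈ S` (the
  cokernel is killed by `a`) then `a` annihilates `(S/j(P))^∨`; `pow_mem_annihilator_…` for `a = π^k`;
* `exact_dual_conj` — the same exact pair transported along `R`-linear isomorphisms on the middle and
  right objects (`X_m/(a)^m X_m ≃ (Sel[a^m])^∨` of `PontryaginCongruence`, and (b) `θ_m` on `Q_m`), in the
  shape `ι : Kd → N'`, `β : N' → Q` consumed by the EndForm theorem.

References: [Castella2018Erratum] proof of Thm. 1.1 (p. 4); memo PROOF-BDP §31.2 (F), §32.8 (G1);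
`X11b/PontryaginCongruence.lean` (multr1-p1).
-/

set_option autoImplicit false
-- the Theorems namespace of this sub repeats the summit name by design (D-0017 nested layout)
set_option linter.dupNamespace false

noncomputable section

open CharacterModule

namespace Summit.BirchSwinnertonDyer.BirchSwinnertonDyer.Theorems.PontryaginDefect

variable {R : Type*} [CommRing R] {P S : Type*} [AddCommGroup P] [Module R P] [AddCommGroup S]
  [Module R S]

/-- The dual `(S/U)^∨ → S^∨` of the quotient map is injective (dual of a surjection). [folklore] -/
theorem dual_mkQ_injective (U : Submodule R S) : Function.Injective (dual U.mkQ) :=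
  dual_injective_of_surjective _ (Submodule.mkQ_surjective U)

/-- `j` injective ⟹ `j^∨ : S^∨ → P^∨` surjective (`ℚ/ℤ` is an injective `ℤ`-module; Mathlib
`CharacterModule.dual_surjective_of_injective`, restated in the shape used below). [folklore] -/
theorem dual_surjective_of_injective' (j : P →ₗ[R] S) (hj : Function.Injective j) :
    Function.Surjective (dual j) :=
  dual_surjective_of_injective j hj

/-- `j^∨ ∘ (S/j(P))^∨-inclusion = 0`: a character pulled back from `S/j(P)` vanishes on `j(P)`. [folklore] -/
theorem dual_comp_dual_mkQ_range (j : P →ₗ[R] S) (ψ : CharacterModule (S ⧸ LinearMap.range j)) :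
    dual j (dual (LinearMap.range j).mkQ ψ) = 0 := by
  refine CharacterModule.ext (A := P) fun x => ?_
  change ψ ((LinearMap.range j).mkQ (j x)) = 0
  rw [Submodule.mkQ_apply, (Submodule.Quotient.mk_eq_zero _).mpr (LinearMap.mem_range_self j x),
    map_zero]

/-- **Exactness of the dual sequence at `S^∨`: `ker (j^∨ : S^∨ → P^∨) = im ((S/j(P))^∨ → S^∨)`.** A
character `χ` of `S` with `χ ∘ j = 0` vanishes on `j(P)`, hence factors through the quotient `S/j(P)`
(as an additive map into `ℚ/ℤ`); conversely such characters die under `j^∨`. This is the (left)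
exactness of `Hom_ℤ(−, ℚ/ℤ)` applied to `P → S → S/j(P) → 0`. [folklore] -/
theorem exact_dual_mkQ_dual (j : P →ₗ[R] S) :
    Function.Exact (dual (LinearMap.range j).mkQ) (dual j) := by
  intro χ
  constructor
  · intro hχ
    -- `χ` vanishes on `j(P)`
    have hvan : ((LinearMap.range j).restrictScalars ℤ) ≤ LinearMap.ker χ.toIntLinearMap := by
      rintro _ ⟨x, rfl⟩
      rw [LinearMap.mem_ker]
      exact congr($hχ x)
    let χbar : (S ⧸ (LinearMap.range j).restrictScalars ℤ) →ₗ[ℤ] AddCircle (1 : ℚ) :=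
      ((LinearMap.range j).restrictScalars ℤ).liftQ χ.toIntLinearMap hvan
    let e : (S ⧸ (LinearMap.range j).restrictScalars ℤ) ≃ₗ[ℤ] (S ⧸ LinearMap.range j) :=
      Submodule.Quotient.restrictScalarsEquiv ℤ (LinearMap.range j)
    refine ⟨χbar.toAddMonoidHom.comp e.symm.toLinearMap.toAddMonoidHom, ?_⟩
    refine CharacterModule.ext (A := S) fun s => ?_
    change χbar (e.symm ((LinearMap.range j).mkQ s)) = χ s
    have h2 : e.symm ((LinearMap.range j).mkQ s) = Submodule.Quotient.mk s :=
      Submodule.Quotient.restrictScalarsEquiv_symm_mk ℤ (LinearMap.range j) s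
    rw [h2]
    rfl
  · rintro ⟨ψ, rfl⟩
    exact dual_comp_dual_mkQ_range j ψ

/-- **An annihilator of the cokernel annihilates its dual**: if `a • s ∈ j(P)` for every `s ∈ S` (i.e.
`a` kills `S/j(P)`), then `a` kills `(S/j(P))^∨` (`(a • ψ)(s̄) = ψ(a • s̄) = ψ(0)`). In T♭: `a = p^k` kills
the control defect (Lemma 2.1♭ + (L1)), hence its Pontryagin dual `K'_m`, uniformly in `m`. [folklore] -/
theorem mem_annihilator_characterModule_of_forall_smul_mem (j : P →ₗ[R] S) (a : R)
    (ha : ∀ s : S, a • s ∈ LinearMap.range j) :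
    a ∈ Module.annihilator R (CharacterModule (S ⧸ LinearMap.range j)) := by
  rw [Module.mem_annihilator]
  intro ψ
  refine CharacterModule.ext (A := S ⧸ LinearMap.range j) fun q => ?_
  obtain ⟨s, rfl⟩ := Submodule.mkQ_surjective (LinearMap.range j) q
  change ψ (a • (LinearMap.range j).mkQ s) = 0
  rw [← map_smul, Submodule.mkQ_apply, (Submodule.Quotient.mk_eq_zero _).mpr (ha s), map_zero]

/-- The same for an annihilator given on the quotient directly: `a • q = 0` for all `q ∈ S/U` ⟹ `a`
annihilates `(S/U)^∨`. [folklore] -/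
theorem mem_annihilator_characterModule_of_forall_smul_eq_zero {Q : Type*} [AddCommGroup Q]
    [Module R Q] (a : R) (ha : ∀ q : Q, a • q = 0) :
    a ∈ Module.annihilator R (CharacterModule Q) := by
  rw [Module.mem_annihilator]
  intro ψ
  refine CharacterModule.ext (A := Q) fun q => ?_
  change ψ (a • q) = 0
  rw [ha q, map_zero]

/-- **The dual exact pair transported along isomorphisms** (the shape consumed by
`BoundedCongruenceLimit.charIdeal_le_span_of_congruences_boundedKernel`): for `j : P → S` `R`-linear and
`R`-linear isomorphisms `eS : N' ≃ S^∨` (e.g. `X_m/(a)^m X_m ≃ (Sel[a^m])^∨` of `PontryaginCongruence`) and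
`eP : P^∨ ≃ Q` (e.g. the dual of the (b)-isomorphism `Sel(M_{g_m}[a^m]) ≃ Sel(M_f[a^m])`), the maps
`ι := eS⁻¹ ∘ (S/j(P))^∨-inclusion : (S/j(P))^∨ → N'` and `β := eP ∘ j^∨ ∘ eS : N' → Q` form an exact pair,
and `β` is surjective when `j` is injective. [folklore] -/
theorem exact_dual_conj (j : P →ₗ[R] S) {N' Q : Type*} [AddCommGroup N'] [Module R N']
    [AddCommGroup Q] [Module R Q] (eS : N' ≃ₗ[R] CharacterModule S) (eP : CharacterModule P ≃ₗ[R] Q) :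
    Function.Exact ((eS.symm : CharacterModule S →ₗ[R] N') ∘ₗ dual (LinearMap.range j).mkQ)
      ((eP : CharacterModule P →ₗ[R] Q) ∘ₗ dual j ∘ₗ (eS : N' →ₗ[R] CharacterModule S)) := by
  have h := exact_dual_mkQ_dual j
  rw [← LinearEquiv.conj_exact_iff_exact _ _ eS.symm, LinearEquiv.symm_symm] at h
  rw [LinearEquiv.postcomp_exact_iff_exact]
  exact h

/-- Surjectivity of the transported `β` when `j` is injective. [folklore] -/
theorem dual_conj_surjective (j : P →ₗ[R] S) (hj : Function.Injective j) {N' Q : Type*}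
    [AddCommGroup N'] [Module R N'] [AddCommGroup Q] [Module R Q]
    (eS : N' ≃ₗ[R] CharacterModule S) (eP : CharacterModule P ≃ₗ[R] Q) :
    Function.Surjective
      ((eP : CharacterModule P →ₗ[R] Q) ∘ₗ dual j ∘ₗ (eS : N' →ₗ[R] CharacterModule S)) := by
  rw [LinearMap.coe_comp, LinearMap.coe_comp]
  exact eP.surjective.comp ((dual_surjective_of_injective j hj).comp eS.surjective)

/-- Injectivity of the transported `ι`. [folklore] -/
theorem dual_conj_injective (j : P →ₗ[R] S) {N' : Type*} [AddCommGroup N'] [Module R N']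
    (eS : N' ≃ₗ[R] CharacterModule S) :
    Function.Injective ((eS.symm : CharacterModule S →ₗ[R] N') ∘ₗ dual (LinearMap.range j).mkQ) := by
  rw [LinearMap.coe_comp]
  exact eS.symm.injective.comp (dual_mkQ_injective (LinearMap.range j))

end Summit.BirchSwinnertonDyer.BirchSwinnertonDyer.Theorems.PontryaginDefect

end
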